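/-
Copyright (c) 2026. Released under the Apache 2.0 license.
-/
import Mathlib.NumberTheory.Padics.Complex
import Literature.NumberTheory.Automorphic.FuchsianGamma0Cusps
import Literature.NumberTheory.EllipticCurves.Newforms
import Literature.NumberTheory.EllipticCurves.ModularCurveCuspsProofs
import HarnessLib

/-!
# `p`-adic valuations of the Fourier coefficients of weight-`2` newforms on `Γ₀(N)` at ALL cusps
# (Česnavičius–Neururer–Saha, JEMS 26 (2024), Cor. 4.7 — the weight-`2` case of Thm. 1.3 = Thm. 4.6)

The source. K. Česnavičius, M. Neururer, A. Saha, *The Manin constant and the modular degree*,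
J. Eur. Math. Soc. 26 (2024), no. 2, 573–637 (bib key `CesnaviciusNeururerSaha2023`; full text
held as `paper:url-5d7cab36bb8f` = the authors' final version of 27 March 2022, 51 pp.; §4 =
pp. 28–31). This is the automorphic input of their integrality theorem
`ω_f ∈ H⁰(X₀(N), Ω)` (Thm. 5.15, "(⋆)") and hence of `c_φ ∣ deg φ` (Thm. 1.1/1.2, tree:
`cesnaviciusNeururerSaha_thm_1_1`, `cesnaviciusNeururerSaha_thm_1_2`): "(⋆) amounts to certain
bounds on the `p`-adic valuations of the denominators of the Fourier coefficients of `f` at all the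
cusps of `X₀(N)_ℂ` … we use automorphic methods to establish the following stronger bounds" (§1,
p. 4). The weight-`2` case, Cor. 4.7 (p. 31: "We explicate the weight 2 case of Theorem 4.6 because
it is the most relevant one for our goals"), is transcribed here; the weight-`k` Thm. 4.6
(= Thm. 1.3) is left as a `TODO(general form)`.

## The printed definitions (§4.1–4.2, pp. 28–29), and their rendering

* (§4.1) "each cusp `𝔠` of `Γ₀(N)` is represented by an `m/L ∈ ℚ ⊂ ℙ¹(ℚ)` with `gcd(m, N) = 1` and a
  uniquely determined denominator `L ∣ N` of `𝔠` … For `𝔠 = (a b; c d)∞`, we have `L = gcd(c, N)`.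
  … The width of a cusp `𝔠` is the smallest `w(𝔠) ∈ ℤ_{>0}` such that `γ (1 w(𝔠); 0 1) γ⁻¹ ∈ Γ₀(N)`
  for any fixed `γ ∈ SL₂(ℤ)` with `𝔠 = γ∞`, explicitly, `w(𝔠) = N / gcd(L², N)`."
  ↦ `cuspDenominator N γ = gcd(|c|, N)` for `γ = (a b; c d) ∈ SL(2, ℤ)` (a definition), and the
  width is the tree's `Literature.NumberTheory.Automorphic.Fuchsian.cuspWidth N c = N / gcd(N, c²)`
  (`FuchsianGamma0Cusps.lean`, whose `conj_T_zpow_mem_Gamma0_iff` PROVES that it is the smallest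
  such `w`; `gcd(N, c²) = gcd(gcd(c, N)², N)`, so it is the printed `N / gcd(L², N)`).
* (§4.2) "`(f|_k γ)(z) := det(γ)^{k/2} (cz + d)^{-k} f((az + b)/(cz + d))`" — for `γ ∈ SL₂(ℤ)` this
  is Mathlib's slash action, `(f ∣[k] γ) τ = f(γ • τ) · denom γ τ ^ (-k)`
  (`ModularForm.SL_slash_apply`); "(4.2.1) `f(z) = ∑_{n ≥ 0} a_f(n) e^{2πinz/w}`" and (p. 29)
  "`(f|_kγ)|_k (1 w(𝔠); 0 1) = f|_kγ`, so (4.2.1) gives the Fourier expansion of `f` at `𝔠`: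
  `(f|_kγ)(z) = ∑_{n ≥ 0} a_f(n; γ) e^{2πinz/w(𝔠)}`, which depends not only on `𝔠` but also on
  `γ` — explicitly, for any `γ' ∈ SL₂(ℤ)` with `𝔠 = γ'∞`, `a_f(n;γ) = e^{2πint/w(𝔠)} a_f(n;γ')`
  for some `t ∈ ℤ`" ↦ `fourierCoeffAtCusp N k f γ n`, the
  `n`-th coefficient of Mathlib's width-`w` `q`-expansion `UpperHalfPlane.qExpansion w (f ∣[k] γ)`
  (`q_w = e^{2πiτ/w}`, the same parameter as (4.2.1)).
* (4.2.2) "for any isomorphism `ℚ̄_p ≃ ℂ` and the resulting `p`-adic valuation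
  `val_p : ℂ → ℚ ∪ {∞}`, `val_p(f|𝔠) := inf_{n ≥ 0} (val_p(a_f(n;γ)))` depends only on `f` and `𝔠`,
  and not on `γ`." ↦ we quantify over ring isomorphisms `ι : PadicAlgCl p ≃+* ℂ` (Mathlib
  `PadicAlgCl p = \overline{ℚ_p}` with its spectral norm, `‖p‖ = p⁻¹`, so `val_p(x) = -log_p ‖x‖`
  and `val_p(x) ≥ e ⟺ ‖x‖ ≤ p^{-e}`; such `ι` exist: `PadicAlgCl.nonempty_ringEquiv_complex` in
  `Literature/FieldTheory/AlgClosed/PadicAlgClEquivComplex.lean`) and over ALL `n` and ALL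
  representatives `γ` (the norm of `a_f(n;γ)` is `γ`-independent, roots of unity having norm `1`),
  so "`val_p(f|𝔠) ≥ B`" becomes "`‖ι⁻¹(a_f(n;γ))‖ ≤ p^{-B}` for all `n`".

## The printed theorem (Cor. 4.7, p. 31), verbatim

"For a prime `p`, a `ℤ`-linear combination `f` of normalized newforms of weight `2` on `Γ₀(N)`, a
cusp `𝔠 ∈ X₀(N)(ℂ)` of denominator `L`, and an isomorphism `ℂ ≃ ℚ̄_p`,
`val_p(f|𝔠) ≥ -val_p(N/L) + { 0 if val_p(L) ∈ {0, val_p(N)};  max(1/2, 1/(p-1)) if val_p(L) = 1,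
val_p(N) = 2;  1 if val_p(L) ∈ {1, val_p(N) - 1}, val_p(N) > 2;  1 + ½ val_2(N) if p = 2,
val_2(L) = ½ val_2(N) ∈ {2, 3, 4};  2 + ¼ val_2(N) if p = 2, val_2(L) = ½ val_2(N) > 4;  3 if p = 2,
val_2(L) ∈ {3, val_2(N) - 3}, val_2(N) > 6;  1 + ½ val_p(gcd(L, N/L)) otherwise }`."
The brace is transcribed as the real-valued `cesnaviciusNeururerSahaCuspBound p v_L v_N` with the
printed rows in the printed order (first applicable row; `val_p(gcd(L, N/L)) = min(v_L, v_N - v_L)`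
since `L ∣ N`), and "`ℤ`-linear combination of normalized newforms of weight `2` on `Γ₀(N)`" as
`f ∈ Submodule.span ℤ (newforms0 N 2)` (`newforms0 N 2 = {f | IsNewform0 f}`: new at level `N`,
Hecke eigenform, `a₁ = 1` — `Newforms.lean`). Example 4.8 / Tables 4.8.1–2 (p. 31) show the rows
are SHARP for newforms of elliptic curves and `p ≤ 11`.

## Contents
* `cuspDenominator` (+ `cuspDenominator_dvd`), `fourierCoeffAtCusp`,
  `cesnaviciusNeururerSahaCuspBound`;
* the named fact `cesnaviciusNeururerSaha_cor_4_7` (statement only) and two proved unpacking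
  lemmas: the row "`0` if `val_p(L) ∈ {0, val_p(N)}`" at the cusp `∞` (`γ = 1`, `L = N`:
  integrality of the `q`-expansion at `∞`, `‖ι⁻¹ a_n‖ ≤ 1`) and at `p ∤ N`.

## References
* [CesnaviciusNeururerSaha2023] op. cit., §4.1–4.2 (pp. 28–29), Lemma 4.5, Thm. 4.6 (p. 30),
  Cor. 4.7 and Example 4.8 (p. 31); Thm. 1.3 (p. 4).
* [Ngo2024] T. Ngo, *On roots of quadratic congruences*, Lemma 2.4 (1) (the width `q/gcd(q, ν²)`,
  tree `Fuchsian.cuspWidth`).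
* [DiamondShurman2005] F. Diamond, J. Shurman, *A first course in modular forms*, §1.2, §3.8
  (cusps of `Γ₀(N)`, widths).
-/

noncomputable section

open scoped MatrixGroups ModularForm

open CongruenceSubgroup UpperHalfPlane Complex
open Literature.NumberTheory.Automorphic (Fuchsian.cuspWidth)

namespace Literature.NumberTheory.EllipticCurves.ModularForms

/-! ### Cusps of `Γ₀(N)`: denominator, width, Fourier coefficients at a cusp -/

section Cusps

variable (N : ℕ)

/-- **The denominator of the cusp `γ∞` of `Γ₀(N)`** (ČNS §4.1, p. 28: "For `𝔠 = (a b; c d)∞`, we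
have `L = gcd(c, N)`"; `L ∣ N`, and the cusp `∞ = 1·∞` has denominator `N`).
[cite: CesnaviciusNeururerSaha2023, §4.1 (p. 28)] -/
def cuspDenominator (γ : SL(2, ℤ)) : ℕ :=
  Nat.gcd ((γ : Matrix (Fin 2) (Fin 2) ℤ) 1 0).natAbs N

/-- `L ∣ N` (ČNS §4.1: "a uniquely determined denominator `L ∣ N`").
[cite: CesnaviciusNeururerSaha2023, §4.1 (p. 28)] -/
theorem cuspDenominator_dvd (γ : SL(2, ℤ)) : cuspDenominator N γ ∣ N :=
  Nat.gcd_dvd_right _ _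

/-- The cusp `∞ = 1 · ∞` has denominator `N` (`c = 0`, `gcd(0, N) = N`; ČNS §4.1: "The cusp `∞` is
the unique one of denominator `N`"). [cite: CesnaviciusNeururerSaha2023, §4.1 (p. 28)] -/
@[simp] theorem cuspDenominator_one : cuspDenominator N 1 = N := by
  simp [cuspDenominator]

/-- **The Fourier coefficient `a_f(n; γ)` of `f` (weight `k`) at the cusp `γ∞` of `Γ₀(N)`** (ČNS
§4.2, p. 29): the `n`-th coefficient of the expansion `(f|_k γ)(z) = ∑_{n ≥ 0} a_f(n;γ) e^{2πinz/w}`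
in the parameter `e^{2πiz/w}`, `w = w(γ∞)` the width — rendered with Mathlib's slash action
`f ∣[k] γ` (`= f(γz)(cz+d)^{-k}`, `ModularForm.SL_slash_apply`) and width-`w` `q`-expansion
`UpperHalfPlane.qExpansion w`, the width being the tree's `Fuchsian.cuspWidth N c = N/gcd(N, c²)`
(`= N/gcd(L², N)`, the printed formula). Depends on the representative `γ` of the cusp only up to
roots of unity (p. 29). [cite: CesnaviciusNeururerSaha2023, §4.2 (p. 29), display after (4.2.1)] -/
def fourierCoeffAtCusp (k : ℤ) (f : ℍ → ℂ) (γ : SL(2, ℤ)) (n : ℕ) : ℂ :=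
  (qExpansion (Fuchsian.cuspWidth N ((γ : Matrix (Fin 2) (Fin 2) ℤ) 1 0) : ℝ) (f ∣[k] γ)).coeff n

/-- At `γ = 1` (the cusp `∞`, width `N/gcd(N, 0) = 1`) the coefficients `a_f(n; 1)` are the
ordinary `q`-expansion coefficients `a_n(f)` (`qExpansion 1 f`; ČNS §4.2 (4.2.1) at `∞`).
[cite: CesnaviciusNeururerSaha2023, §4.2 (4.2.1)] -/
theorem fourierCoeffAtCusp_one [NeZero N] (k : ℤ) (f : ℍ → ℂ) (n : ℕ) :
    fourierCoeffAtCusp N k f 1 n = (qExpansion 1 f).coeff n := by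
  have hw : (Fuchsian.cuspWidth N (((1 : SL(2, ℤ)) : Matrix (Fin 2) (Fin 2) ℤ) 1 0) : ℝ) = 1 := by
    simp [Fuchsian.cuspWidth, Nat.div_self (Nat.pos_of_ne_zero (NeZero.ne N))]
  rw [fourierCoeffAtCusp, hw, SlashAction.slash_one]

end Cusps

/-! ### The printed bound of Cor. 4.7 -/

/-- **The brace of ČNS Cor. 4.7** as a function of `p`, `v_L = val_p(L)`, `v_N = val_p(N)` (rows in
the printed order, first applicable row wins): `0` if `v_L ∈ {0, v_N}`; `max(1/2, 1/(p-1))` if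
`v_L = 1, v_N = 2`; `1` if `v_L ∈ {1, v_N - 1}, v_N > 2`; `1 + v_N/2` if `p = 2`,
`v_L = v_N/2 ∈ {2,3,4}`; `2 + v_N/4` if `p = 2`, `v_L = v_N/2 > 4`; `3` if `p = 2`,
`v_L ∈ {3, v_N - 3}`, `v_N > 6`; `1 + ½ val_p(gcd(L, N/L)) = 1 + ½ min(v_L, v_N - v_L)` otherwise.
[cite: CesnaviciusNeururerSaha2023, Cor. 4.7 (p. 31)] -/
def cesnaviciusNeururerSahaCuspBound (p vL vN : ℕ) : ℝ :=
  if vL = 0 ∨ vL = vN then 0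
  else if vL = 1 ∧ vN = 2 then max (1 / 2) (1 / ((p : ℝ) - 1))
  else if (vL = 1 ∨ vL = vN - 1) ∧ 2 < vN then 1
  else if p = 2 ∧ 2 * vL = vN ∧ (vL = 2 ∨ vL = 3 ∨ vL = 4) then 1 + (vN : ℝ) / 2
  else if p = 2 ∧ 2 * vL = vN ∧ 4 < vL then 2 + (vN : ℝ) / 4
  else if p = 2 ∧ (vL = 3 ∨ vL = vN - 3) ∧ 6 < vN then 3
  else 1 + (min vL (vN - vL) : ℝ) / 2

/-- The first row: `v_L ∈ {0, v_N}` gives the bound `0`.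
[cite: CesnaviciusNeururerSaha2023, Cor. 4.7 (p. 31)] -/
theorem cesnaviciusNeururerSahaCuspBound_of_eq_zero_or_eq {p vL vN : ℕ} (h : vL = 0 ∨ vL = vN) :
    cesnaviciusNeururerSahaCuspBound p vL vN = 0 := by
  unfold cesnaviciusNeururerSahaCuspBound
  rw [if_pos h]

/-! ### Cor. 4.7 (the weight-`2` case of Thm. 1.3 = Thm. 4.6) -/

/-- **Česnavičius–Neururer–Saha 2024, Cor. 4.7 (`p`-adic valuations of the Fourier expansions of
weight-`2` newforms on `Γ₀(N)` at all cusps).** Printed (JEMS 26 (2024), Cor. 4.7, p. 31 of the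
authors' final version), verbatim: "For a prime `p`, a `ℤ`-linear combination `f` of normalized
newforms of weight `2` on `Γ₀(N)`, a cusp `𝔠 ∈ X₀(N)(ℂ)` of denominator `L`, and an isomorphism
`ℂ ≃ ℚ̄_p`, `val_p(f|𝔠) ≥ -val_p(N/L) + {0 if val_p(L) ∈ {0, val_p(N)}; max(1/2, 1/(p-1)) if
val_p(L) = 1, val_p(N) = 2; 1 if val_p(L) ∈ {1, val_p(N)-1}, val_p(N) > 2; 1 + ½val_2(N) if p = 2,
val_2(L) = ½val_2(N) ∈ {2,3,4}; 2 + ¼val_2(N) if p = 2, val_2(L) = ½val_2(N) > 4; 3 if p = 2,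
val_2(L) ∈ {3, val_2(N)-3}, val_2(N) > 6; 1 + ½val_p(gcd(L, N/L)) otherwise}`", where (4.2.2)
`val_p(f|𝔠) := inf_{n ≥ 0} val_p(a_f(n;γ))` for any `γ ∈ SL₂(ℤ)` with `𝔠 = γ∞`. Rendering (module
docstring): for every level `N ≥ 1`, prime `p`, `f ∈ S₂(Γ₀(N))` in the `ℤ`-span of the newforms
(`newforms0 N 2`), every `γ ∈ SL(2, ℤ)` (cusp `γ∞`, denominator `L = cuspDenominator N γ`), every
ring isomorphism `ι : ℚ̄_p ≃ ℂ` (`PadicAlgCl p`) and every `n`: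
`‖ι⁻¹(a_f(n;γ))‖ ≤ p ^ (val_p(N) - val_p(L) - B)` with `B = cesnaviciusNeururerSahaCuspBound p
val_p(L) val_p(N)` the printed brace — i.e. `val_p(a_f(n;γ)) ≥ -val_p(N/L) + B` for all `n`
(`‖p‖ = p⁻¹` on `ℚ̄_p`; `val_p(N/L) = val_p(N) - val_p(L)` as `L ∣ N`). FAITHFUL to print (weight
`2`; the weight-`k` Thm. 4.6 = Thm. 1.3 is not transcribed). Named fact (statement only).
[cite: CesnaviciusNeururerSaha2023, Cor. 4.7 (p. 31); Thm. 1.3 (p. 4) = Thm. 4.6 (p. 30)] -/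
def cesnaviciusNeururerSaha_cor_4_7 : Prop :=
  ∀ (N : ℕ) [NeZero N] (p : ℕ) [Fact p.Prime] (f : CuspForm (Gamma0 N) 2),
    f ∈ Submodule.span ℤ (newforms0 N 2) →
    ∀ (γ : SL(2, ℤ)) (ι : PadicAlgCl p ≃+* ℂ) (n : ℕ),
      ‖ι.symm (fourierCoeffAtCusp N 2 ⇑f γ n)‖ ≤
        (p : ℝ) ^ (((padicValNat p N - padicValNat p (cuspDenominator N γ) : ℕ) : ℝ) -
          cesnaviciusNeururerSahaCuspBound p (padicValNat p (cuspDenominator N γ))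
            (padicValNat p N))

-- TODO(general form): Thm. 4.6 (= Thm. 1.3), weight `k` newforms on `Γ₀(N)`: the term
-- `-(k/2) val_p(N/gcd(L², N))` and the two printed braces (all `p`; sharper rows at `p = 2`).

/-- **Unpacking at the cusp `∞`** (`γ = 1`, `L = N`, row "`0` if `val_p(L) = val_p(N)`", and
`val_p(N/L) = 0`): under the fact, the ordinary `q`-expansion coefficients of such an `f` satisfy
`‖ι⁻¹(a_n(f))‖ ≤ 1`, i.e. are `p`-integral for every `p` — the classical integrality at `∞`
(ČNS §4.3, p. 29: "for a normalized newform `f` on `Γ₀(N)` and every prime `p`, we have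
`val_p(f|∞) = 0`"). [cite: CesnaviciusNeururerSaha2023, Cor. 4.7 (p. 31) and §4.3 (p. 29)] -/
theorem norm_qExpansion_coeff_le_one_of_cor_4_7 (h : cesnaviciusNeururerSaha_cor_4_7)
    {N : ℕ} [NeZero N] {p : ℕ} [Fact p.Prime] (f : CuspForm (Gamma0 N) 2)
    (hf : f ∈ Submodule.span ℤ (newforms0 N 2)) (ι : PadicAlgCl p ≃+* ℂ) (n : ℕ) :
    ‖ι.symm ((qExpansion 1 ⇑f).coeff n)‖ ≤ 1 := by
  have := h N p f hf 1 ι n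
  rwa [fourierCoeffAtCusp_one, cuspDenominator_one, Nat.sub_self, Nat.cast_zero,
    cesnaviciusNeururerSahaCuspBound_of_eq_zero_or_eq (Or.inr rfl), sub_zero,
    Real.rpow_zero] at this

/-- **Unpacking at a prime `p ∤ N`** (`val_p(N) = val_p(L) = 0`, first row, `val_p(N/L) = 0`):
under the fact, `‖ι⁻¹(a_f(n;γ))‖ ≤ 1` at EVERY cusp — ČNS (4.5.1): "if `p ∤ N`, then
`val_p(f|𝔠) ≥ 0`". [cite: CesnaviciusNeururerSaha2023, Lemma 4.5 (4.5.1) (p. 30); Cor. 4.7] -/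
theorem norm_fourierCoeffAtCusp_le_one_of_not_dvd (h : cesnaviciusNeururerSaha_cor_4_7)
    {N : ℕ} [NeZero N] {p : ℕ} [Fact p.Prime] (hpN : ¬ p ∣ N) (f : CuspForm (Gamma0 N) 2)
    (hf : f ∈ Submodule.span ℤ (newforms0 N 2)) (γ : SL(2, ℤ)) (ι : PadicAlgCl p ≃+* ℂ) (n : ℕ) :
    ‖ι.symm (fourierCoeffAtCusp N 2 ⇑f γ n)‖ ≤ 1 := by
  have hN : padicValNat p N = 0 := padicValNat.eq_zero_of_not_dvd hpN
  have hL : padicValNat p (cuspDenominator N γ) = 0 :=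
    padicValNat.eq_zero_of_not_dvd fun hd ↦ hpN (hd.trans (cuspDenominator_dvd N γ))
  have := h N p f hf γ ι n
  rwa [hN, hL, Nat.sub_self, Nat.cast_zero,
    cesnaviciusNeururerSahaCuspBound_of_eq_zero_or_eq (Or.inl rfl), sub_zero,
    Real.rpow_zero] at this

/-! ### The cusp criterion of Prop. 5.14 (the `q`-expansion form of `ω_f ∈ H⁰(X₀(N)_{ℤ_p}, Ω)`)
### holds for `ℤ`-combinations of weight-`2` newforms — proved from Cor. 4.7 (proof of Thm. 5.15)

ČNS Prop. 5.14 (p. 39), verbatim: "For a prime `p` and a cuspform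
`f ∈ H⁰(X₀(N)_{ℚ̄_p}, ω^{⊗2}(−cusps))`, the differential `ω_f ∈ H⁰(X₀(N)_{ℚ̄_p}, Ω¹)` lies in
the `ℤ̄_p`-lattice `H⁰(X₀(N)_{ℤ̄_p}, Ω)` … if and only if for every `0 ≤ ℓ ≤ val_p(N)` and some
(equivalently, any) cusp `𝔠 ∈ X₀(N)(ℚ̄_p)` whose denominator `L` satisfies `ℓ = val_p(L)` and some
(equivalently, any) isomorphism `ι : ℚ̄_p ≃ ℂ`, we have `val_p(ι(f)|ι(𝔠)) ≥ {−val_p(N) if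
val_p(L) = 0; −val_p(N/L) + 1/(p−1) if 0 < val_p(L) < val_p(N); 0 if val_p(L) = val_p(N)}`."
and Thm. 5.15 (p. 40, the integrality theorem (⋆) `ω_f ∈ H⁰(X₀(N)_{O_K}, Ω)`), proof: "by
Proposition 5.14, we need to check that … the valuation `val_p(ι(λ(f))|𝔠)` satisfies the bound
(5.14.1). This, however, follows from Corollary 4.7." The
geometric side (the lattice `H⁰(X₀(N)_{ℤ_p}, Ω)`, the relative dualizing sheaf) has no tree
vocabulary; the RIGHT-HAND SIDE of Prop. 5.14 — the three valuation bounds at the cusps — is stated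
and PROVED below from the named fact `cesnaviciusNeururerSaha_cor_4_7`, exactly as in print (each of
the seven rows of the Cor. 4.7 brace is `≥` the Prop. 5.14 row). So, modulo Prop. 5.14 (geometry ↔
`q`-expansions), these three theorems ARE the content of (⋆) at `p` for such `f`. -/

/-- The Cor. 4.7 brace dominates the middle row of Prop. 5.14: for `0 < v_L < v_N` (and `p` prime),
`1/(p−1) ≤ cesnaviciusNeururerSahaCuspBound p v_L v_N` (rows 2–7 of Cor. 4.7 are
`max(1/2, 1/(p−1))`, `1`, `1 + v_N/2`, `2 + v_N/4`, `3`, `1 + ½min(v_L, v_N − v_L)`, each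
`≥ 1/(p−1)` as `p ≥ 2`).
[cite: CesnaviciusNeururerSaha2023, Prop. 5.14 (p. 39) with Cor. 4.7 (p. 31)] -/
theorem one_div_sub_one_le_cesnaviciusNeururerSahaCuspBound {p vL vN : ℕ} (hp : p.Prime)
    (h0 : 0 < vL) (hlt : vL < vN) :
    1 / ((p : ℝ) - 1) ≤ cesnaviciusNeururerSahaCuspBound p vL vN := by
  have hp2 : (2 : ℝ) ≤ p := by exact_mod_cast hp.two_le
  have h1 : 1 / ((p : ℝ) - 1) ≤ 1 := by
    rw [div_le_one (by linarith)]
    linarith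
  have hN : (0 : ℝ) ≤ vN := Nat.cast_nonneg _
  have hL : (0 : ℝ) ≤ vL := Nat.cast_nonneg _
  unfold cesnaviciusNeururerSahaCuspBound
  split_ifs with h₁ h₂ h₃ h₄ h₅ h₆
  · omega
  · exact le_max_right _ _
  · exact h1
  · linarith
  · linarith
  · linarith
  · have hle : (vL : ℝ) ≤ vN := by exact_mod_cast hlt.le
    have hmin : (0 : ℝ) ≤ min (vL : ℝ) ((vN : ℝ) - vL) := le_min hL (sub_nonneg.mpr hle)
    linarith

/-- **Prop. 5.14, row `val_p(L) = 0` (e.g. the cusp `0`), from Cor. 4.7**: for a `ℤ`-combination `f`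
of weight-`2` newforms on `Γ₀(N)`, a cusp `γ∞` whose denominator `L` is prime to `p`, any
`ι : ℚ̄_p ≃ ℂ` and all `n`: `‖ι⁻¹(a_f(n;γ))‖ ≤ p^{val_p(N)}`, i.e. `val_p(f|𝔠) ≥ −val_p(N)` (the
first row of Cor. 4.7 is exactly this).
[cite: CesnaviciusNeururerSaha2023, Prop. 5.14 (p. 39), row val_p(L) = 0; Cor. 4.7] -/
theorem norm_fourierCoeffAtCusp_le_pow_of_padicValNat_eq_zero (h : cesnaviciusNeururerSaha_cor_4_7)
    {N : ℕ} [NeZero N] {p : ℕ} [Fact p.Prime] (f : CuspForm (Gamma0 N) 2)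
    (hf : f ∈ Submodule.span ℤ (newforms0 N 2)) (γ : SL(2, ℤ)) (ι : PadicAlgCl p ≃+* ℂ) (n : ℕ)
    (hL : padicValNat p (cuspDenominator N γ) = 0) :
    ‖ι.symm (fourierCoeffAtCusp N 2 ⇑f γ n)‖ ≤ (p : ℝ) ^ padicValNat p N := by
  have := h N p f hf γ ι n
  rwa [hL, Nat.sub_zero, cesnaviciusNeururerSahaCuspBound_of_eq_zero_or_eq (Or.inl rfl), sub_zero,
    Real.rpow_natCast] at this

/-- **Prop. 5.14, row `0 < val_p(L) < val_p(N)`, from Cor. 4.7**: for a `ℤ`-combination `f` of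
weight-`2` newforms on `Γ₀(N)`, a cusp `γ∞` of denominator `L` with `0 < val_p(L) < val_p(N)`, any
`ι : ℚ̄_p ≃ ℂ` and all `n`: `‖ι⁻¹(a_f(n;γ))‖ ≤ p^{val_p(N/L) − 1/(p−1)}`, i.e.
`val_p(f|𝔠) ≥ −val_p(N/L) + 1/(p−1)` ("This, however, follows from Corollary 4.7", proof of
Thm. 5.15).
[cite: CesnaviciusNeururerSaha2023, Prop. 5.14 (p. 39), middle row; Thm. 5.15 proof (p. 40)] -/
theorem norm_fourierCoeffAtCusp_le_rpow_of_pos_of_lt (h : cesnaviciusNeururerSaha_cor_4_7)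
    {N : ℕ} [NeZero N] {p : ℕ} [Fact p.Prime] (f : CuspForm (Gamma0 N) 2)
    (hf : f ∈ Submodule.span ℤ (newforms0 N 2)) (γ : SL(2, ℤ)) (ι : PadicAlgCl p ≃+* ℂ) (n : ℕ)
    (h0 : 0 < padicValNat p (cuspDenominator N γ))
    (hlt : padicValNat p (cuspDenominator N γ) < padicValNat p N) :
    ‖ι.symm (fourierCoeffAtCusp N 2 ⇑f γ n)‖ ≤
      (p : ℝ) ^ (((padicValNat p N - padicValNat p (cuspDenominator N γ) : ℕ) : ℝ) -
        1 / ((p : ℝ) - 1)) := by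
  refine (h N p f hf γ ι n).trans (Real.rpow_le_rpow_of_exponent_le ?_ ?_)
  · exact_mod_cast (Fact.out : p.Prime).one_lt.le
  · linarith [one_div_sub_one_le_cesnaviciusNeururerSahaCuspBound (vN := padicValNat p N)
      (Fact.out : p.Prime) h0 hlt]

/-- **Prop. 5.14, row `val_p(L) = val_p(N)` (e.g. the cusp `∞`), from Cor. 4.7**: for a
`ℤ`-combination `f` of weight-`2` newforms on `Γ₀(N)`, a cusp `γ∞` of denominator `L` with
`val_p(L) = val_p(N)`, any `ι : ℚ̄_p ≃ ℂ` and all `n`: `‖ι⁻¹(a_f(n;γ))‖ ≤ 1`, i.e. `val_p(f|𝔠) ≥ 0`.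
[cite: CesnaviciusNeururerSaha2023, Prop. 5.14 (p. 39), row val_p(L) = val_p(N); Cor. 4.7] -/
theorem norm_fourierCoeffAtCusp_le_one_of_padicValNat_eq (h : cesnaviciusNeururerSaha_cor_4_7)
    {N : ℕ} [NeZero N] {p : ℕ} [Fact p.Prime] (f : CuspForm (Gamma0 N) 2)
    (hf : f ∈ Submodule.span ℤ (newforms0 N 2)) (γ : SL(2, ℤ)) (ι : PadicAlgCl p ≃+* ℂ) (n : ℕ)
    (hL : padicValNat p (cuspDenominator N γ) = padicValNat p N) :
    ‖ι.symm (fourierCoeffAtCusp N 2 ⇑f γ n)‖ ≤ 1 := by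
  have := h N p f hf γ ι n
  rwa [hL, Nat.sub_self, Nat.cast_zero,
    cesnaviciusNeururerSahaCuspBound_of_eq_zero_or_eq (Or.inr rfl), sub_zero, Real.rpow_zero]
    at this

/-! ### The denominator is the tree's cusp invariant: ČNS §4.1 ↔ `ModularCurveCuspsProofs`
(appended 2026-08-26: dictionary to the classification `cuspInv`/`CuspIndex`/`cuspOrbitsEquiv` of the
cusps of `Γ₀(N)`, Diamond–Shurman §3.8; theorems only) -/

section CuspDictionary

variable (N : ℕ)

/-- **Dictionary.** The ČNS denominator `L = gcd(c, N)` of the cusp `γ∞` (§4.1, p. 28) IS the tree's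
cusp invariant `cuspDivisor N γ = Int.gcd (γ 1 0) N` of `ModularCurveCuspsProofs.lean` — the first
component of the classifying invariant `cuspInv N γ ∈ CuspIndex N = ∐_{d ∣ N} (ℤ/gcd(d, N/d)ℤ)ˣ`
(`cuspOrbitsEquiv : CuspOrbits(Γ₀(N)) ≃ CuspIndex N`), so that everything proved there about
`cuspDivisor` applies to `cuspDenominator`. [cite: CesnaviciusNeururerSaha2023, §4.1 (p. 28)]
[cite: DiamondShurman2005, §3.8] -/
theorem cuspDenominator_eq_cuspDivisor (γ : SL(2, ℤ)) : cuspDenominator N γ = cuspDivisor N γ := rfl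

/-- **For every `L ∣ N` there is a cusp of denominator `L`**, namely `1/L = (1 0; L 1)∞`
(`gcd(L, N) = L`) (ČNS §4.1: "each cusp … is represented by an `m/L` … with … a uniquely determined
denominator `L ∣ N`"; Prop. 5.14 quantifies over "some (equivalently, any) cusp whose denominator `L`
satisfies `ℓ = val_p(L)`" for every `0 ≤ ℓ ≤ val_p(N)`). [cite: CesnaviciusNeururerSaha2023, §4.1 (p. 28)] -/
theorem exists_cuspDenominator_eq {L : ℕ} (hL : L ∣ N) : ∃ γ : SL(2, ℤ), cuspDenominator N γ = L := by
  refine ⟨⟨!![1, 0; (L : ℤ), 1], by norm_num [Matrix.det_fin_two_of]⟩, ?_⟩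
  simp [cuspDenominator, Nat.gcd_eq_left hL]

variable [NeZero N]

/-- **The denominator is a function of the cusp `𝔠 = Γ₀(N)γ∞ ∈ X₀(N)(ℂ)`** ("a uniquely determined
denominator `L ∣ N` of `𝔠`", §4.1): `Γ₀(N)`-equivalent representatives have the same denominator
(the classification `cuspOrbitOf_eq_iff_cuspInv_eq` of `ModularCurveCuspsProofs.lean`, first
component). [cite: CesnaviciusNeururerSaha2023, §4.1 (p. 28)] [cite: DiamondShurman2005, Prop. 3.8.3] -/
theorem cuspDenominator_eq_of_cuspOrbitOf_eq {γ γ' : SL(2, ℤ)} (h : cuspOrbitOf N γ = cuspOrbitOf N γ') :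
    cuspDenominator N γ = cuspDenominator N γ' :=
  congrArg (fun x : CuspIndex N ↦ ((x.1 : N.divisors) : ℕ)) ((cuspOrbitOf_eq_iff_cuspInv_eq N γ γ').mp h)

/-- Left `Γ₀(N)`-invariance: `L(δγ∞) = L(γ∞)` for `δ ∈ Γ₀(N)`.
[cite: CesnaviciusNeururerSaha2023, §4.1 (p. 28)] [cite: DiamondShurman2005, Prop. 3.8.3] -/
theorem cuspDenominator_mul_left_of_mem_Gamma0 {δ : SL(2, ℤ)} (hδ : δ ∈ Gamma0 N) (γ : SL(2, ℤ)) :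
    cuspDenominator N (δ * γ) = cuspDenominator N γ :=
  congrArg (fun x : CuspIndex N ↦ ((x.1 : N.divisors) : ℕ)) (cuspInv_mul_left N hδ γ)

/-- Right invariance under the stabiliser `{±(1 *; 0 1)}` of `∞` in `SL₂(ℤ)` (§4.1:
`cusps(Γ₀(N)) ≅ (Γ₀(N) ∩ SL₂(ℤ)) \ SL₂(ℤ) / {±(1 *; 0 1)}`; the representative `γ` of `𝔠 = γ∞` is
determined up to it): `L((γp)∞) = L(γ∞)` whenever `p₁₀ = 0`.
[cite: CesnaviciusNeururerSaha2023, §4.1 (p. 28)] -/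
theorem cuspDenominator_mul_right_of_apply_eq_zero (γ : SL(2, ℤ)) {p : SL(2, ℤ)} (hp : p 1 0 = 0) :
    cuspDenominator N (γ * p) = cuspDenominator N γ :=
  congrArg (fun x : CuspIndex N ↦ ((x.1 : N.divisors) : ℕ)) (cuspInv_mul_right N γ hp)

/-- The classifying bijection sends the cusp `Γ₀(N)γ∞` to the invariant of `γ` (by construction of
`cuspOrbitsEquiv` as the quotient of `SL₂(ℤ)` by the common kernel relation; Diamond–Shurman §3.8: the
cusp `Γ₀(N)(a/c)` ↦ `(gcd(c, N), a·(c/d))`). [cite: DiamondShurman2005, §3.8 (p. 103)] -/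
theorem cuspOrbitsEquiv_cuspOrbitOf (γ : SL(2, ℤ)) :
    cuspOrbitsEquiv N (cuspOrbitOf N γ) = cuspInv N γ := by
  have h : (Setoid.quotientKerEquivOfSurjective _ (cuspOrbitOf_surjective N)) (Quotient.mk _ γ) =
      cuspOrbitOf N γ := rfl
  rw [← h, cuspOrbitsEquiv, Equiv.trans_apply, Equiv.trans_apply, Equiv.symm_apply_apply]
  rfl

omit [NeZero N] in
/-- The fibre of `CuspIndex N = ∐_{d ∣ N} (ℤ/gcd(d, N/d)ℤ)ˣ` over `d = L` has `φ(gcd(L, N/L))`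
elements (Diamond–Shurman §3.8, p. 103: "for each `d ∣ N` there are exactly `φ(gcd(d, N/d))` cusps").
[cite: DiamondShurman2005, §3.8 (p. 103)] -/
theorem card_cuspIndex_fst_eq {L : ℕ} (hL : L ∈ N.divisors) :
    Nat.card {y : CuspIndex N // ((y.1 : N.divisors) : ℕ) = L} = Nat.totient (Nat.gcd L (N / L)) := by
  haveI : NeZero (Nat.gcd L (N / L)) := ⟨Nat.gcd_ne_zero_left (Nat.pos_of_mem_divisors hL).ne'⟩
  rw [← ZMod.card_units_eq_totient, ← Nat.card_eq_fintype_card]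
  refine (Nat.card_congr (Equiv.ofBijective
    (fun u : (ZMod (Nat.gcd L (N / L)))ˣ ↦
      (⟨⟨⟨L, hL⟩, u⟩, rfl⟩ : {y : CuspIndex N // ((y.1 : N.divisors) : ℕ) = L})) ⟨?_, ?_⟩)).symm
  · intro u v huv
    exact eq_of_heq (Sigma.mk.inj_iff.mp (Subtype.ext_iff.mp huv)).2
  · rintro ⟨⟨⟨d, hd⟩, u⟩, h⟩
    change d = L at h
    subst h
    exact ⟨u, rfl⟩

/-- **"There are `φ(gcd(L, N/L))` cusps of denominator `L`"** (ČNS §4.1, p. 28, citing [DS05,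
Prop. 3.8.3]): for `L ∣ N`, the cusps `𝔠 ∈ X₀(N)(ℂ) = Γ₀(N) \ ℙ¹(ℚ)` (Mathlib `CuspOrbits`) all of
whose representatives `γ` (`𝔠 = Γ₀(N)γ∞`) have denominator `L` number `φ(gcd(L, N/L))` — PROVED from
the tree's classification `cuspOrbitsEquiv` (`ModularCurveCuspsProofs.lean`).
[cite: CesnaviciusNeururerSaha2023, §4.1 (p. 28)] [cite: DiamondShurman2005, §3.8 (p. 103)] -/
theorem card_cuspOrbits_cuspDenominator_eq {L : ℕ} (hL : L ∣ N) :
    Nat.card {x : CuspOrbits (Gamma0 N : Subgroup (GL (Fin 2) ℝ)) //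
        ∀ γ : SL(2, ℤ), cuspOrbitOf N γ = x → cuspDenominator N γ = L} =
      Nat.totient (Nat.gcd L (N / L)) := by
  rw [← card_cuspIndex_fst_eq N (Nat.mem_divisors.mpr ⟨hL, NeZero.ne N⟩)]
  refine Nat.card_congr ((cuspOrbitsEquiv N).subtypeEquiv fun x ↦ ?_)
  obtain ⟨γ₀, rfl⟩ := cuspOrbitOf_surjective N x
  rw [cuspOrbitsEquiv_cuspOrbitOf]
  refine ⟨fun h ↦ h γ₀ rfl, fun h γ hγ ↦ ?_⟩
  rw [cuspDenominator_eq_of_cuspOrbitOf_eq N hγ]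
  exact h

/-- **"The cusp `∞` is the unique one of denominator `N`"** (§4.1, p. 28) in orbit language: a cusp
all of whose representatives have denominator `N` is `Γ₀(N)·∞ = cuspOrbitOf N 1`; with
`cuspDenominator_eq_level_iff_mem_Gamma0` (`NewformCuspFourierValuationWeightK.lean`) and the count
`φ(gcd(N, 1)) = 1`. [cite: CesnaviciusNeururerSaha2023, §4.1 (p. 28)] -/
theorem cuspOrbitOf_eq_cuspOrbitOf_one_of_cuspDenominator_eq {γ : SL(2, ℤ)}
    (h : cuspDenominator N γ = N) : cuspOrbitOf N γ = cuspOrbitOf N 1 := by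
  have h' : N ∣ ((γ : Matrix (Fin 2) (Fin 2) ℤ) 1 0).natAbs := Nat.gcd_eq_right_iff_dvd.mp h
  rw [cuspOrbitOf_eq_iff]
  refine ⟨γ, ?_, by simp⟩
  rw [Gamma0_mem, ZMod.intCast_zmod_eq_zero_iff_dvd]
  exact Int.natCast_dvd.mpr h'

end CuspDictionary

end Literature.NumberTheory.EllipticCurves.ModularForms

end
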